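import Literature.NumberTheory.Sieve.RoughOmegaCellsClassesBV
import HarnessLib

/-!
# Route `RoughParitySectors`, crux `OddSectorShareLinear` (stmt-Parity-15629), line `birth`:
# the registered stub `stub_roughCellsBV` (B: Bombieri–Vinogradov for the Ω-cells of the rough integers,
# level `X^{1/4}`)

`--supports stmt-Parity-15629` file of the checked skeleton
`Summits/Parity/BatemanHorn/Cruxes/OddSectorShareLinear/Lines/birth.lean`.  Target (registered stub, verbatim):
for every `n` and `A` there is `C ≥ 0` with
`Σ_{q ≤ X^{1/4}} |#{b ∈ roughIcc ⌈Y⌉ ⌊X⌋ : Ω b = j+1, b ≡ c_q (q)} − #{b ∈ roughIcc ⌈Y⌉ ⌊X⌋ : Ω b = j+1, (b,q)=1}/φ(q)|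
 ≤ C X/(log X)^A` for all `2 ≤ Y ≤ X`, `log X ≤ n log Y`, all cells `j` and all reduced classes `c_q`.
The mathematics lives in `Literature/NumberTheory/Sieve/RoughOmegaCellsClassesBV*.lean` (the averaged
form `RoughCellsAP.exists_sum_abs_cellClassDisc_le` of `RoughCellsAP.exists_abs_cellClassDisc_le`,
from Bombieri–Friedlander–Iwaniec's Theorem 0 (b)); this file is a thin wrapper.
-/


/-
PLAN (worker B, stub_roughCellsBV).  Literature files, namespace `Literature.NumberTheory.Sieve.RoughCellsAP`,
landed bottom-up, then this wrapper.

Notation: `N₀ = ⌈Y⌉₊`, `T = ⌊X⌋₊`, `S = (roughIcc N₀ T).filter (Ω · = j+1)`,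
pairs `𝒫 = ((Icc 1 T) ×ˢ (Icc 1 T)).filter (m rough ∧ Ω m = j ∧ p prime ∧ N₀ ≤ p ∧ m p ≤ T)`,
`D_q(R) = #{(m,p) ∈ R : mp ≡ c_q (q)} − #{(m,p) ∈ R : (mp,q)=1}/φ(q)`.

File 1 `RoughOmegaCellsClassesBVPairs.lean` (combinatorics, no number theory):
 * fiber identity `Σ_{(m,p) ∈ 𝒫} g(mp) = Σ_{b ∈ S} ω(b) g(b)` (fibre of b ≃ b.primeFactors;
   `ArithmeticFunction.cardFactors_mul`, `Nat.primeFactors_mul`);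
 * `ω b ≤ j+1` on `S` with equality iff squarefree
   (`ArithmeticFunction.cardDistinctFactors_eq_cardFactors_iff_squarefree`), whence
   `|cellDisc_q| ≤ |D_q(𝒫)| + ns₁(q) + ns₂/φ(q)`, `ns` = non-squarefree rough `b ≤ T` (in a class);
 * counting lemma `#{b ∈ Icc 1 T : u ∣ b, lo < b, b ≡ c (q)} ≤ (T−lo)/(uq) + 1` for `(u,q)=1`,
   and `#{(m,p) ∈ R : mp ≡ c} ≤ (j+1) #{b ∈ W : b ≡ c}` for `R ⊆ 𝒫` with products in `W`.
File 2 `RoughOmegaCellsClassesBVPrimes.lean` (the prime variable):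
 * `SiegelWalfiszHyp N 1 Csw ⇑(primePiece m m')` for `X^{1/(2n)} ≤ N ≤ X`, `N < m+1`, `m' ≤ 2N`,
   with `Csw` depending on `n` only: small moduli `k ≤ (log 2N)^{4A}` by
   `primePiece_siegelWalfisz_uniform` (Polymath 8b Claim 2.6 for primes, PROVED), large moduli by
   `BFI.abs_disc_le_large` + `inv_totient_le_sigma_zero_div` + `exists_sigma_zero_le_mul_rpow`,
   sparse pieces (`‖β‖² ≤ N (log 2N)^{-2A}`) and small `N` by `BFI.abs_disc_le_two_sum_abs`;
 * the cell `j = 0` (primes in `[N₀, T]` = `primePiece (N₀−1) T`): level `X^{1/4}` from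
   `sum_iSup_apDiscrepancy_primePiece_le` + `BombieriVinogradovStatement_holds.primesHaveLevelPi`.
File 3 `RoughOmegaCellsClassesBVBoxes.lean` (covering the hyperbola):
 * `δ = (log X)^{-(A+3)}`, prime boxes `B_k = {p : prime, N₀ ≤ p, BFI.InBox X δ k p}` (`k < K`,
   `(1+δ)^K > X`), `m`-ranges `A_{k,i} = {m : cell j, BFI.InBox ((1+δ)^k) 1 i m}` (`i < I`,
   `2^I ≍ X^{1/4}`): `A_{k,i} ⊆ dyadic M`, `B_k ⊆ dyadic N`, `M = (1+δ)^k/2^{i+1}`, `N = X/(1+δ)^{k+1}`,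
   `MN = X/((1+δ)2^{i+1}) ∈ [X^{3/4}/2, X/2]`;
 * `exists_inBox` (every `T/(1+Δ)^K < n ≤ T` is in a box `k < K`), disjointness
   (`BFI.InBox.eq_of_inBox`), `⋃ A_{k,i} ×ˢ B_k ⊆ 𝒫`, and
   `𝒫 ∖ ⋃ boxes ⊆ {mp ≤ X/2^I} ∪ {X/(1+δ) < mp}`;
 * `D_q(𝒫) = Σ_{k,i} bilinDisc (c_q) M N 1_{A_{k,i}} 1_{B_k} q + D_q(rest)`, `|D_q(rest)|` and the
   `ns`-terms summed over `q ≤ X^{1/4}`: `≪ n[(δX+1)(1+log X)² + X^{3/4}(1+log X)²] + X(1+log X)²/(Y−1)`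
   (`sum_Icc_one_div_totient_le_sq`, harmonic bound).
File 4 `RoughOmegaCellsClassesBV.lean` (assembly): per box `BombieriFriedlanderIwaniecTheorem0b_holds`
 (`ε = 1/(2n)`, `A' = 2A+5`, `B = 1`, `Csw` of File 2; `x = MN ≥ X^{3/4}/2`, `x^ε ≤ N ≤ x^{1−ε}` from
 `Y/2 ≤ N ≤ 2MN/Y`, level `X^{1/4} ≤ x^{1/2}(log x)^{-B₁}`, `‖1_A‖‖1_B‖ ≤ 3√(MN)`), `K I ≤ 3(log X)^{A+5}`
 boxes; `j ≥ n` empty (`roughIcc_filter_cardFactors_eq_empty`), `j = 0` File 2, small `X` trivial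
 (`RoughCellsAP.abs_cellClassDisc_le_self`-type bound `≤ 2X · X^{1/4}`) ⇒
 `RoughCellsAP.exists_sum_abs_cellClassDisc_le` (exactly the registered shape) ⇒ this wrapper.
-/

noncomputable section

open Finset

namespace Summit.Parity.BatemanHorn.Cruxes.OddSectorShareLinear.Birth

/-- **Stub (B): Bombieri–Vinogradov for the Ω-cells of the rough integers (level `X^{1/4}`)** —
registered stub `stub_roughCellsBV` of crux stmt-Parity-15629 (line `birth`), verbatim; a restatement of
`Literature.NumberTheory.Sieve.RoughCellsAP.exists_sum_abs_cellClassDisc_le` (Motohashi 1976;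
Bombieri–Friedlander–Iwaniec 1986, Theorem 0). [folklore] -/
theorem stub_roughCellsBV :
    ∀ (n : ℕ) (A : ℝ), ∃ C : ℝ, 0 ≤ C ∧ ∀ X Y : ℝ, 2 ≤ Y → Y ≤ X → Real.log X ≤ n * Real.log Y → ∀
    (j : ℕ) (c : ℕ → ℕ), (∀ q : ℕ, 0 < q → (c q).Coprime q) → ∑ q ∈ Finset.Icc 1 ⌊X ^ ((1 : ℝ) /
    4)⌋₊, |((((Literature.NumberTheory.Sieve.roughIcc ⌈Y⌉₊ ⌊X⌋₊).filter (fun b : ℕ =>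
    ArithmeticFunction.cardFactors b = j + 1 ∧ Nat.ModEq q b (c q))).card : ℕ) : ℝ) -
    ((((Literature.NumberTheory.Sieve.roughIcc ⌈Y⌉₊ ⌊X⌋₊).filter (fun b : ℕ =>
    ArithmeticFunction.cardFactors b = j + 1 ∧ b.Coprime q)).card : ℕ) : ℝ) / ((Nat.totient q : ℕ) :
    ℝ)| ≤ C * X / Real.log X ^ A := by
  intro n A
  obtain ⟨C, hC, h⟩ := Literature.NumberTheory.Sieve.RoughCellsAP.exists_sum_abs_cellClassDisc_le n A
  exact ⟨C, hC, fun X Y hY hYX hlog j c hc => h X Y hY hYX hlog j c hc⟩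

end Summit.Parity.BatemanHorn.Cruxes.OddSectorShareLinear.Birth

end
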